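import Summits.ResolutionOfSingularities.ResolutionOfSingularities.Theorems.PurelyInseparableDim4BandLayers
import Summits.ResolutionOfSingularities.ResolutionOfSingularities.Theorems.PurelyInseparableDim4RidgeResidual
import Summits.ResolutionOfSingularities.ResolutionOfSingularities.Theorems.PurelyInseparableDim4IsolatedMultiplicity
import Literature.AlgebraicGeometry.Resolution.CentreBlowupResidueInequality
import HarnessLib
import HarnessLib.Audit.Tags

/-!
# Purely inseparable four-folds — the SHADE NEVER RISES in the isolated band, every prime:
# K2(p) reduces to chains of CONSTANT residual order (idea-4's BCP(p) reduction, kernel form)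

[OURS · counted 0 · cell `res-dim4-pi` · F4-I(p,p) band half (K2(p)) · seat res-dim4-p-12 g2.]
Nothing here proves K2(p), `NoIsolatedTrap p p` or resolution of singularities in dimension ≥ 4 /
characteristic `p`.

Hauser–Perlega's condition (2) in the tree (`CentreBlowup.dvd_of_shadeIncreases`: an increase of the shade
`d = ord₀ F − |r|` at a point of a Moh-permissible coordinate centre forces `q ∣ ord₀ F`) is VACUOUSLY
VIOLATED in the isolated band: along an isolated `Step0 p` chain avoiding the floor every state has
`p < ord₀ F ≤ 2p − 2` (p-5's IB-1 `IsolatedBand.isolated_chain_band`), so `p ∤ ord₀ F` and **the shade never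
rises** — idea-4's letter (K1) of CARD I-4-2/I-4-3 as a frame theorem (§§1–2).  Hence the residual order is
eventually constant on every such chain (§3), and — after re-reading the exceptional multiplicities from
`r₀ = 0` (the frame does not insist on `x^r ∣ F` at the start of a chain; the polynomials of the chain do not
depend on `r₀`, §4) — **K2(p) = `RidgeBudget.NoAboveFloorTrap p p` is EQUIVALENT to «no infinite isolated
above-floor `Step0 p` chain with `x^{r₀} ∣ F₀` and CONSTANT shade»** (`noAboveFloorTrap_iff_noConstantShadeTrap`,
§5) — idea-4's «K2(p) ⟸ BCP(p)» (CARD I-4-2) with its converse.  With `BandLayers.no_isolated_chain_of_orders`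
(p663313) such a constant-shade chain moreover has `ord₀(c_k) + ord₀(c_{k+1}) ≤ 3p − 2` infinitely often (§5).
bears_on: LADDER-RESOLUTION:D157-DOOR2 (res-dim4-pi · F4-I(p,p) · K2(p) ⟺ BCP(p)).  Supports
stmt-ResolutionOfSingularities-16155 (helper).
-/

set_option linter.dupNamespace false -- mandated namespace of this single-conjunct summit

noncomputable section

namespace Summit.ResolutionOfSingularities.ResolutionOfSingularities.Theorems.PIDim4

namespace BandShade

open MvPolynomial Finset
open Literature.AlgebraicGeometry.Resolution
open Literature.AlgebraicGeometry.Resolution.CentreBlowup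
open Literature.AlgebraicGeometry.Resolution.Hauser2010

variable {K : Type} [Field K]

/-! ## 1. One edge: no rise when `q ∤ ord₀ F` -/

/-- **No rise off the multiples of `q`** (Hauser–Perlega (2) for the point centre, frame form): at a point
`b` of the `x_j`-chart (`b_j = 0`), if `x^r ∣ F`, `q ≤ ord₀ F = o` and `q ∤ o`, the shade of the cleaned
transform does not exceed the shade of `s`.  (`CentreBlowup.dvd_of_shadeIncreases` at `S = univ`, where
Moh-permissibility `|r| + d ≤ |e|` is automatic.) [cite: HauserPerlega2019PRIMS, §3 Theorem (2)] -/
theorem shade_step_le_of_not_dvd [DecidableEq K] {q : ℕ} {s : State K} {j : Fin 4} {b : Fin 4 → K}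
    (hbj : b j = 0) {o : ℕ} (ho : ordZero s.F = o) (hqo : q ≤ o) (hndvd : ¬ q ∣ o)
    (hr : ∀ d ∈ s.F.support, s.r ≤ d) :
    (CentreBlowup.step q Finset.univ j b s).shade ≤ s.shade := by
  by_contra hlt
  have hinc : ShadeIncreases q Finset.univ j b s := not_le.mp hlt
  refine hndvd (dvd_of_shadeIncreases q (Finset.mem_univ j) b hbj
    (fun i hi => absurd (Finset.mem_univ i) hi) s ho hr (fun d hd => ?_) (fun d hd => ?_) hinc)
  · rw [degIn_univ]
    have h := Literature.Barriers.ResolutionOfSingularities.ordZero_le_of_coeff_ne_zero _ _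
      (MvPolynomial.mem_support_iff.mp hd)
    rw [ho] at h
    exact le_trans hqo (by exact_mod_cast h)
  · rw [degIn_univ, degIn_univ]
    have hod : o ≤ d.degree := by
      have h := Literature.Barriers.ResolutionOfSingularities.ordZero_le_of_coeff_ne_zero _ _
        (MvPolynomial.mem_support_iff.mp hd)
      rw [ho] at h
      exact_mod_cast h
    have hrd : s.r.degree ≤ d.degree := PointBlowup.degree_le_degree_of_le (hr d hd)
    omega

/-- **No rise along a `Step0 q` edge from a state of order `o` with `q ∤ o`** (`x^r ∣ F` at the parent).
[cite: HauserPerlega2019PRIMS, §3 Theorem (2)] -/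
theorem shade_le_of_step0_of_not_dvd [DecidableEq K] {q : ℕ} {s s' : State K} (h : Step0 q s s')
    {o : ℕ} (ho : ordZero s.F = o) (hndvd : ¬ q ∣ o) (hr : ∀ d ∈ s.F.support, s.r ≤ d) :
    s'.shade ≤ s.shade := by
  obtain ⟨hq, j, b, -, hbj, -, -, rfl⟩ := h
  have hqo : q ≤ o := by
    rw [ordAlong_univ, ho] at hq
    exact_mod_cast hq
  exact shade_step_le_of_not_dvd hbj ho hqo hndvd hr

/-! ## 2. Isolated chains off the floor: the shade is non-increasing -/

/-- An order in the isolated band off the floor is prime to `p`: `p < o ≤ 2p − 2 ⇒ p ∤ o`. [folklore] -/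
theorem not_dvd_of_band {p o : ℕ} (hp : 2 ≤ p) (hpo : p ≤ o) (hne : o ≠ p) (ho : o ≤ 2 * p - 2) :
    ¬ p ∣ o := by
  rintro ⟨k, rfl⟩
  rcases Nat.lt_or_ge k 2 with hk | hk
  · interval_cases k <;> simp_all
  · have : p * 2 ≤ p * k := Nat.mul_le_mul_left p hk
    omega

/-- Along an isolated `Step0 p` chain every order is a natural number in `[p, 2p − 2]` (IB-1). [folklore] -/
theorem exists_ordZero_eq (p : ℕ) [Fact p.Prime] [DecidableEq K] {c : ℕ → State K}
    (hc : ∀ k, IsIsolated p (c k).F ∧ Step0 p (c k) (c (k + 1))) (k : ℕ) :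
    ∃ o : ℕ, ordZero (c k).F = o ∧ p ≤ o ∧ o ≤ 2 * p - 2 := by
  have hp : 2 ≤ p := (Fact.out : p.Prime).two_le
  obtain ⟨hlo, hhi⟩ := IsolatedBand.isolated_chain_band hp hc k
  have hne : ordZero (c k).F ≠ ⊤ := ne_top_of_le_ne_top (ENat.coe_ne_top _) hhi
  obtain ⟨o, ho⟩ := ENat.ne_top_iff_exists.mp hne
  refine ⟨o, ho.symm, ?_, ?_⟩
  · rw [← ho] at hlo; exact_mod_cast hlo
  · rw [← ho] at hhi; exact_mod_cast hhi

/-- **THE SHADE NEVER RISES IN THE ISOLATED BAND** (idea-4's (K1), every prime): along an isolated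
`Step0 p` chain avoiding the floor (`ord₀ ≠ p`) and starting with `x^{r₀} ∣ F₀`, `d(c_{k+1}) ≤ d(c_k)`
for every `k`. [OURS] [cite: HauserPerlega2019PRIMS, §3 Theorem (2)] -/
theorem shade_succ_le (p : ℕ) [Fact p.Prime] [DecidableEq K] {c : ℕ → State K}
    (hc : ∀ k, IsIsolated p (c k).F ∧ Step0 p (c k) (c (k + 1))) (hfloor : ∀ k, ordZero (c k).F ≠ p)
    (hr : ∀ d ∈ (c 0).F.support, (c 0).r ≤ d) (k : ℕ) : (c (k + 1)).shade ≤ (c k).shade := by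
  have hp : 2 ≤ p := (Fact.out : p.Prime).two_le
  obtain ⟨o, ho, hpo, ho2⟩ := exists_ordZero_eq p hc k
  have hne : o ≠ p := fun h => hfloor k (by rw [ho, h])
  exact shade_le_of_step0_of_not_dvd (hc k).2 ho (not_dvd_of_band hp hpo hne ho2)
    (IsolatedBand.isolated_chain_forall_le hc hr k)

/-! ## 3. Hence the shade is eventually constant -/

/-- The shade of a state with `x^r ∣ F` and `ord₀ F = o` is the natural number `o − |r|`. [folklore] -/
theorem shade_eq_coe {s : State K} {o : ℕ} (ho : ordZero s.F = o) :
    s.shade = ((o - s.r.degree : ℕ) : ℕ∞) := by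
  unfold CState.shade
  rw [ho]
  norm_cast

/-- **Eventually constant shade**: along an isolated above-floor `Step0 p` chain with `x^{r₀} ∣ F₀` the
shade takes a constant value from some index on. [OURS] [folklore] -/
theorem shade_eventually_constant (p : ℕ) [Fact p.Prime] [DecidableEq K] {c : ℕ → State K}
    (hc : ∀ k, IsIsolated p (c k).F ∧ Step0 p (c k) (c (k + 1))) (hfloor : ∀ k, ordZero (c k).F ≠ p)
    (hr : ∀ d ∈ (c 0).F.support, (c 0).r ≤ d) :
    ∃ M : ℕ, ∃ d : ℕ∞, ∀ k, M ≤ k → (c k).shade = d := by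
  choose o ho _ _ using exists_ordZero_eq p hc
  set g : ℕ → ℕ := fun k => o k - (c k).r.degree with hg
  have hshade : ∀ k, (c k).shade = (g k : ℕ∞) := fun k => shade_eq_coe (ho k)
  have hanti : Antitone g := by
    refine antitone_nat_of_succ_le fun k => ?_
    have h := shade_succ_le p hc hfloor hr k
    rw [hshade, hshade] at h
    exact_mod_cast h
  obtain ⟨M, hM⟩ := Directrix.exists_eventually_const_of_antitone g hanti
  exact ⟨M, g M, fun k hk => by rw [hshade, hM k hk]⟩

/-! ## 4. Re-reading the multiplicities from `r₀ = 0` -/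

/-- The polynomial of a step depends on the parent only through its polynomial. [folklore] -/
theorem step_F_congr [DecidableEq K] {q : ℕ} {S : Finset (Fin 4)} {j : Fin 4} {b : Fin 4 → K}
    {s t : State K} (h : s.F = t.F) :
    (CentreBlowup.step q S j b s).F = (CentreBlowup.step q S j b t).F := by
  show deletePthPowers q (pointTransform q S j b s) = deletePthPowers q (pointTransform q S j b t)
  unfold pointTransform
  rw [h]

/-- Equimultiplicity of a chart point depends on the parent only through its polynomial. [folklore] -/
theorem isEquimultiplePoint_congr [DecidableEq K] {q : ℕ} {S : Finset (Fin 4)} {j : Fin 4}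
    {b : Fin 4 → K} {s t : State K} (h : s.F = t.F) :
    CentreBlowup.IsEquimultiplePoint q S j b s ↔ CentreBlowup.IsEquimultiplePoint q S j b t := by
  unfold CentreBlowup.IsEquimultiplePoint pointTransform
  rw [h]

/-- **Re-zeroing the boundary**: every isolated `Step0 q` chain has a twin with the SAME polynomials whose
initial multiplicities are `r₀ = 0` (so `x^{r₀} ∣ F₀` trivially): restart the frame's bookkeeping with the
same charts and points. [OURS · frame bookkeeping] [folklore] -/
theorem exists_rezero_chain [DecidableEq K] {q : ℕ} {c : ℕ → State K}
    (hc : ∀ k, IsIsolated q (c k).F ∧ Step0 q (c k) (c (k + 1))) :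
    ∃ c' : ℕ → State K, (∀ k, (c' k).F = (c k).F) ∧ (c' 0).r = 0 ∧
      ∀ k, IsIsolated q (c' k).F ∧ Step0 q (c' k) (c' (k + 1)) := by
  obtain ⟨j, b, hw⟩ := FreeTail.exists_witnesses (K := K) (fun k => (hc k).2)
  let c' : ℕ → State K := fun k =>
    Nat.rec (⟨(c 0).F, 0, (c 0).exc⟩ : State K)
      (fun k s => CentreBlowup.step q Finset.univ (j k) (b k) s) k
  have hc'0 : c' 0 = ⟨(c 0).F, 0, (c 0).exc⟩ := rfl
  have hc's : ∀ k, c' (k + 1) = CentreBlowup.step q Finset.univ (j k) (b k) (c' k) := fun k => rfl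
  have hF : ∀ k, (c' k).F = (c k).F := by
    intro k
    induction k with
    | zero => rfl
    | succ k ih =>
      obtain ⟨-, -, -, -, hstep⟩ := hw k
      rw [hc's, hstep]
      exact step_F_congr ih
  refine ⟨c', hF, by rw [hc'0], fun k => ⟨by rw [hF]; exact (hc k).1, ?_⟩⟩
  obtain ⟨hq, hbj, heq, hne, hstep⟩ := hw k
  refine ⟨by rw [hF]; exact hq, j k, b k, Finset.mem_univ _, hbj, (isEquimultiplePoint_congr (hF k)).mpr heq,
    ?_, hc's k⟩
  rw [step_F_congr (hF k), ← hstep, ← hF (k + 1), hc's, step_F_congr (hF k), ← hstep]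
  rw [hstep]
  exact hne

/-! ## 5. K2(p) ⟺ no constant-shade above-floor trap -/

/-- **K2(p) ⟸ BCP(p)** (idea-4 CARD I-4-2, kernel form; every prime): if no field of characteristic `p`
carries an infinite isolated `Step0 p` chain avoiding the floor, with `x^{r₀} ∣ F₀` and CONSTANT shade, then
`RidgeBudget.NoAboveFloorTrap p p` holds — re-zero the boundary (§4), let the non-increasing shade settle
(§3), and pass to the tail. [OURS · glue] [folklore] -/
theorem noAboveFloorTrap_of_noConstantShadeTrap (p : ℕ) [Fact p.Prime]
    (h : ∀ (K : Type) [Field K] [CharP K p] [DecidableEq K],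
      ¬ ∃ (c : ℕ → State K) (d : ℕ∞), (∀ e ∈ (c 0).F.support, (c 0).r ≤ e) ∧
        ∀ k, IsIsolated p (c k).F ∧ Step0 p (c k) (c (k + 1)) ∧ ordZero (c k).F ≠ p ∧
          (c k).shade = d) :
    RidgeBudget.NoAboveFloorTrap p p := by
  intro K _ _ _
  rintro ⟨c, hc⟩
  obtain ⟨c', hF, hr0, hc'⟩ := exists_rezero_chain (fun k => ⟨(hc k).1, (hc k).2.1⟩)
  have hfloor : ∀ k, ordZero (c' k).F ≠ p := fun k => by rw [hF]; exact (hc k).2.2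
  have hr : ∀ e ∈ (c' 0).F.support, (c' 0).r ≤ e := fun e _ => by rw [hr0]; exact bot_le
  obtain ⟨M, d, hM⟩ := shade_eventually_constant p hc' hfloor hr
  refine h K ⟨fun k => c' (M + k), d, ?_, fun k => ⟨(hc' (M + k)).1, ?_, hfloor (M + k), ?_⟩⟩
  · exact IsolatedBand.isolated_chain_forall_le hc' hr M
  · have := (hc' (M + k)).2
    rwa [show M + k + 1 = M + (k + 1) by ring] at this
  · exact hM (M + k) (Nat.le_add_right M k)

/-- Conversely a constant-shade above-floor trap is an above-floor trap, so **K2(p) ⟺ BCP(p)** in the frame.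
[OURS · glue] [folklore] -/
theorem noAboveFloorTrap_iff_noConstantShadeTrap (p : ℕ) [Fact p.Prime] :
    RidgeBudget.NoAboveFloorTrap p p ↔ ∀ (K : Type) [Field K] [CharP K p] [DecidableEq K],
      ¬ ∃ (c : ℕ → State K) (d : ℕ∞), (∀ e ∈ (c 0).F.support, (c 0).r ≤ e) ∧
        ∀ k, IsIsolated p (c k).F ∧ Step0 p (c k) (c (k + 1)) ∧ ordZero (c k).F ≠ p ∧
          (c k).shade = d := by
  refine ⟨fun h K _ _ _ => ?_, noAboveFloorTrap_of_noConstantShadeTrap p⟩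
  rintro ⟨c, d, -, hc⟩
  exact h K ⟨c, fun k => ⟨(hc k).1, (hc k).2.1, (hc k).2.2.1⟩⟩

/-- **Where a band trap must live** (with `BandLayers.no_isolated_chain_of_orders`, p663313): along every
infinite isolated `Step0 p` chain, beyond every index some two consecutive orders sum to `≤ 3p − 2` — the
chain visits the LOWER band again and again. [OURS · glue] [folklore] -/
theorem exists_low_pair (p : ℕ) [Fact p.Prime] [CharP K p] [DecidableEq K] {c : ℕ → State K}
    (hc : ∀ k, IsIsolated p (c k).F ∧ Step0 p (c k) (c (k + 1))) (k₀ : ℕ) :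
    ∃ k o o' : ℕ, k₀ ≤ k ∧ ordZero (c k).F = (o : ℕ∞) ∧ ordZero (c (k + 1)).F = (o' : ℕ∞) ∧
      o + o' + 2 ≤ 3 * p := by
  choose o ho _ _ using exists_ordZero_eq p hc
  by_contra hno
  push Not at hno
  refine BandLayers.no_isolated_chain_of_orders p (c := fun k => c (k₀ + k))
    (fun k => ⟨(hc (k₀ + k)).1, by simpa only [Nat.add_succ] using (hc (k₀ + k)).2⟩)
    (fun k => o (k₀ + k)) (fun k => (ho (k₀ + k)).ge) fun k => ?_
  show 3 * p ≤ o (k₀ + k) + o (k₀ + k + 1) + 1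
  have h := hno (k₀ + k) (o (k₀ + k)) (o (k₀ + k + 1)) (Nat.le_add_right _ _) (ho _) (ho _)
  omega

end BandShade

end Summit.ResolutionOfSingularities.ResolutionOfSingularities.Theorems.PIDim4

end
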